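import Mathlib
import Summits.Ventures.PercRepro.TriangleCapResidueMin

/-!
# PercRepro — THE STRICT RESIDUE BOUNDS: TWO PARTIAL VALUES COST `2`, AND `I ≠ r` COSTS `2` (p3, gen 56; part 320)

The arithmetic behind the necessity of the thresholds of part 319.  (1) `Σ c (D − c) ≥ φ_D(Σ c)` (part 301) is
strict by at least `2` as soon as two of the values lie strictly between `0` and `D`: for such `c₁, c₂`,
`c₁ (D − c₁) + c₂ (D − c₂) ≥ φ_D(c₁ + c₂) + 2` (the surplus is `2 c₁ c₂` when `c₁ + c₂ ≤ D` and `2 (D − c₁)(D − c₂)`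
beyond; `phi_pair_add_two`), then subadditivity (`sum_mul_sub_ge_phi_add_two`).  (2) For `2 ≤ r = t mod D`,
`2 r ≤ D`, the function `I ↦ 2 I + φ_D(t + I) + φ_D(t − I)` exceeds its minimum `2 r (D − 2 r + 1)` by at least `2`
off `I = r` (`residue_strict_half`: `I = 0` costs `2 r (r − 1)`, `1 ≤ I < r` costs `2 ((r − I)(r + I − 1) − 1) + 2`,
`I > r` costs `2 (I − r)` by subadditivity).  Axioms: standard.
-/

namespace PercRepro

namespace TriangleCap

namespace C047

open Finset

/-- **TWO PARTIAL VALUES:** for `0 < c₁, c₂ < D`, `φ_D(c₁ + c₂) + 2 ≤ c₁ (D − c₁) + c₂ (D − c₂)`. -/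
theorem phi_pair_add_two (D c₁ c₂ : ℕ) (h1 : 1 ≤ c₁) (h1' : c₁ < D) (h2 : 1 ≤ c₂) (h2' : c₂ < D) :
    phiD D (c₁ + c₂) + 2 ≤ c₁ * (D - c₁) + c₂ * (D - c₂) := by
  obtain ⟨e₁, rfl⟩ : ∃ e₁, D = c₁ + (e₁ + 1) := ⟨D - c₁ - 1, by omega⟩
  rcases Nat.lt_or_ge (c₁ + c₂) (c₁ + (e₁ + 1)) with hlt | hge
  · -- `c₂ ≤ e₁`: the surplus is `2 c₁ c₂`
    obtain ⟨f, hf⟩ : ∃ f, e₁ + 1 = c₂ + f := ⟨e₁ + 1 - c₂, by omega⟩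
    rw [phiD_of_lt _ _ hlt]
    have s1 : c₁ + (e₁ + 1) - (c₁ + c₂) = f := by omega
    have s2 : c₁ + (e₁ + 1) - c₁ = e₁ + 1 := by omega
    have s3 : c₁ + (e₁ + 1) - c₂ = c₁ + f := by omega
    rw [s1, s2, s3, hf]
    nlinarith
  · -- `c₂ > e₁`: the surplus is `2 (D − c₁)(D − c₂)`
    obtain ⟨g, rfl⟩ : ∃ g, c₂ = e₁ + 1 + g := ⟨c₂ - (e₁ + 1), by omega⟩
    obtain ⟨h, rfl⟩ : ∃ h, c₁ = g + 1 + h := ⟨c₁ - g - 1, by omega⟩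
    unfold phiD
    rw [Nat.mod_eq_sub_mod hge, Nat.mod_eq_of_lt (by omega)]
    have s1 : g + 1 + h + (e₁ + 1 + g) - (g + 1 + h + (e₁ + 1)) = g := by omega
    have s2 : g + 1 + h + (e₁ + 1) - g = e₁ + h + 2 := by omega
    have s3 : g + 1 + h + (e₁ + 1) - (g + 1 + h) = e₁ + 1 := by omega
    have s4 : g + 1 + h + (e₁ + 1) - (e₁ + 1 + g) = h + 1 := by omega
    rw [s1, s2, s3, s4]
    nlinarith

/-- **THE φ-SUM WITH TWO PARTIAL VALUES:** `φ_D(Σ c) + 2 ≤ Σ c (D − c)` as soon as two of the values lie strictly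
between `0` and `D`. -/
theorem sum_mul_sub_ge_phi_add_two {ι : Type*} [DecidableEq ι] (s : Finset ι) (c : ι → ℕ) (D : ℕ)
    (hc : ∀ i ∈ s, c i ≤ D) (i₁ i₂ : ι) (hi₁ : i₁ ∈ s) (hi₂ : i₂ ∈ s) (hne : i₁ ≠ i₂) (h1 : 1 ≤ c i₁)
    (h1' : c i₁ < D) (h2 : 1 ≤ c i₂) (h2' : c i₂ < D) :
    phiD D (∑ i ∈ s, c i) + 2 ≤ ∑ i ∈ s, c i * (D - c i) := by
  have hi₂' : i₂ ∈ s.erase i₁ := mem_erase.mpr ⟨hne.symm, hi₂⟩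
  rw [← sum_erase_add s _ hi₁, ← sum_erase_add (s.erase i₁) _ hi₂',
    ← sum_erase_add s (fun i => c i * (D - c i)) hi₁, ← sum_erase_add (s.erase i₁) (fun i => c i * (D - c i)) hi₂']
  have hrest := sum_mul_sub_ge_phi ((s.erase i₁).erase i₂) c D
    (fun i hi => hc i (mem_of_mem_erase (mem_of_mem_erase hi)))
  have hpair := phi_pair_add_two D (c i₂) (c i₁) h2 h2' h1 h1'
  have hsub := phiD_add_le D (∑ i ∈ (s.erase i₁).erase i₂, c i) (c i₂ + c i₁)
  have e : ∑ i ∈ (s.erase i₁).erase i₂, c i + c i₂ + c i₁ = ∑ i ∈ (s.erase i₁).erase i₂, c i + (c i₂ + c i₁) := by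
    ring
  rw [e]
  omega

/-- `φ_D(2 r) = 2 r (D − 2 r)` for `2 r ≤ D`. -/
theorem phiD_two_mul_of_le (D r : ℕ) (h : 2 * r ≤ D) : phiD D (2 * r) = 2 * r * (D - 2 * r) := by
  rcases Nat.lt_or_ge (2 * r) D with hlt | hge
  · exact phiD_of_lt D (2 * r) hlt
  · have : 2 * r = D := by omega
    rw [this, phiD_self, Nat.sub_self, mul_zero]

/-- **THE STRICT RESIDUE BOUND FOR `2 ≤ r = t mod D ≤ D / 2`:** off `I = r`,
`2 r (D − 2 r + 1) + 2 ≤ 2 I + φ_D(t + I) + φ_D(t − I)`. -/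
theorem residue_strict_half (D t I : ℕ) (hD : 0 < D) (hI : I ≤ t) (hr : 2 ≤ t % D) (h2 : 2 * (t % D) ≤ D)
    (hIr : I ≠ t % D) :
    2 * ((t % D) * (D - 2 * (t % D) + 1)) + 2 ≤ 2 * I + phiD D (t + I) + phiD D (t - I) := by
  set r := t % D with hr'
  have hrD : r < D := Nat.mod_lt t hD
  have htarget : 2 * (r * (D - 2 * r + 1)) = 2 * r + phiD D (2 * r) := by
    rw [phiD_two_mul_of_le D r h2]
    ring
  rcases Nat.eq_zero_or_pos I with rfl | hI1
  · -- `I = 0`: `2 φ_D(r) = 2 r (D − r) = target + 2 r (r − 1)`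
    simp only [add_zero, Nat.sub_zero, mul_zero, zero_add]
    rw [phiD_mod D t, ← hr', phiD_of_lt D r hrD, htarget, phiD_two_mul_of_le D r h2]
    obtain ⟨u, hu⟩ : ∃ u, D = 2 * r + u := ⟨D - 2 * r, by omega⟩
    have s1 : D - r = r + u := by omega
    have s2 : D - 2 * r = u := by omega
    rw [s1, s2]
    nlinarith
  · rcases Nat.lt_or_ge I r with hIr' | hIr''
    · -- `1 ≤ I < r`
      have h1 : phiD D (t + I) = (r + I) * (D - r - I) := by
        rw [phiD_mod, Nat.add_mod, ← hr', Nat.mod_eq_of_lt (show I < D by omega),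
          Nat.mod_eq_of_lt (show r + I < D by omega), phiD_of_lt D _ (by omega), Nat.sub_sub]
      have h2' : phiD D (t - I) = (r - I) * (D - r + I) := by
        have ht : t - I = D * (t / D) + (r - I) := by
          have := Nat.div_add_mod t D
          omega
        rw [phiD_mod, ht, Nat.mul_add_mod, Nat.mod_eq_of_lt (by omega : r - I < D), phiD_of_lt D _ (by omega)]
        congr 1
        omega
      rw [h1, h2', htarget, phiD_two_mul_of_le D r h2]
      have hpr : 1 * 1 ≤ (r - I) * (r + I - 1) := Nat.mul_le_mul (by omega) (by omega)
      zify [hIr'.le, (by omega : r ≤ D), (by omega : 2 * r ≤ D), (by omega : r + I ≤ D), (by omega : 1 ≤ r),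
        (by omega : 1 ≤ r + I), (by omega : I ≤ D - r)] at hpr ⊢
      nlinarith [hpr]
    · -- `I > r`: subadditivity
      have hIr2 : r + 1 ≤ I := by omega
      have hsub : phiD D (2 * t) ≤ phiD D (t + I) + phiD D (t - I) := by
        have := phiD_add_le D (t + I) (t - I)
        have e : t + I + (t - I) = 2 * t := by omega
        rw [e] at this
        exact this
      rw [phiD_two_mul_mod, ← hr'] at hsub
      rw [htarget]
      omega

end C047

end TriangleCap

end PercRepro
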